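import Summits.ResolutionOfSingularities.ResolutionOfSingularities.Theorems.ValuativeLuAlphaPTorsorAdaptedDefs
import Summits.ResolutionOfSingularities.ResolutionOfSingularities.Theorems.ValuativeLuAlphaPTorsorAPDict
import Summits.ResolutionOfSingularities.ResolutionOfSingularities.Theorems.ValuativeLuAlphaPTorsorAPLift
import Summits.ResolutionOfSingularities.ResolutionOfSingularities.Theorems.ValuativeLuAlphaPTorsorAPOne
import Summits.ResolutionOfSingularities.ResolutionOfSingularities.Theorems.ValuativeLuAlphaPTorsorAPStep1b
import Summits.ResolutionOfSingularities.ResolutionOfSingularities.Theorems.ValuativeLuAlphaPTorsorAPStep2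
import Summits.ResolutionOfSingularities.ResolutionOfSingularities.Theorems.ValuativeLuAlphaPTorsorAPStep3
import Summits.ResolutionOfSingularities.ResolutionOfSingularities.Theorems.ValuativeLuAlphaPTorsorPerronExplicit
import Summits.ResolutionOfSingularities.ResolutionOfSingularities.Theorems.ValuativeLuAlphaPTorsorTopCoarsening
import Summits.ResolutionOfSingularities.ResolutionOfSingularities.Theorems.ValuativeLuAlphaPTorsorResidualChart
import Literature.AlgebraicGeometry.Resolution.CompositeValuations
import Literature.AlgebraicGeometry.Resolution.TranscendenceDefect
import Mathlib.RingTheory.FiniteType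
import Mathlib.RingTheory.Noetherian.Basic
import Mathlib.Algebra.Algebra.Subalgebra.Lattice
import HarnessLib

/-!
# Perron monomialization on flag-adapted charts, any rank (S3*, the level induction)

Crux `Valuative.LuAlphaPTorsor` (stmt-ResolutionOfSingularities-0641), line `pfaff-line-log-final-forms`,
lead seat c4 — the attack on the rank `≥ 2` Abhyankar core `stub_abhyankarHigherRankCore`: of the
unconditional rank-one proof (`stub_rankOneAbhyankar`, `…Theorems.ValuativeLuAlphaPTorsorRankOne`)
only the Zariski–Perron monomialization uses rank one. `ap_adaptedPerron` runs it LEVEL BY LEVEL on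
a FLAG-ADAPTED chart (`FlagAdaptedChart`): by strong induction on the number of parameters — the
landed rank-one explicit monomialization `perronMonomialization_explicit` on the top coarsening `W`
(F⁴ᵃ `stub_topCoarsening`, hypothesis `hF4a`), the residual chart in `κ(W)` (F⁴ᵇ
`stub_residualChart`, hypothesis `hF4b`), the induction hypothesis for the residue valuation ring
`O/𝔪_W`, the LIFT of the residual re-parametrization (`u = x_S^{C'}`) with the type-2 torsion fix
(`z = x_T / (Q^{N₀} E)`, `…APLift`), and the UP-lemma (`…APUp`). The construction is recorded
(`R' = k[R ∪ x']`, `x'` Laurent monomials in `x`, old parameters / the `a_j` / the given monomials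
of value `≤ 1` as `ℕ`-monomials times units). One-level charts are the rank-one case (the lattice
is archimedean by `LevelArchimedean` and value torsion). [folklore] (Zariski 1940 Thm 2; Cutkosky
2022 §4 — WITHOUT completions.)
-/

set_option linter.dupNamespace false

open IsLocalRing

namespace Summit.ResolutionOfSingularities.ResolutionOfSingularities.Theorems.PfaffLine

open Literature.AlgebraicGeometry.Resolution

/-! ### The level induction S3* -/

section Main

set_option maxHeartbeats 800000 in
/-- **Perron monomialization on FLAG-ADAPTED charts, any rank (S3*)** — by induction on the number
of parameters: the landed rank-one explicit monomialization `perronMonomialization_explicit` on the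
top coarsening (F⁴ᵃ `stub_topCoarsening`), the residual chart (F⁴ᵇ `stub_residualChart`), the
induction hypothesis in the residue field, LIFT with the type-2 torsion fix, and the UP-lemma.
The construction is recorded (`R' = k[R ∪ x']`, `x'` Laurent monomials in `x`). [folklore] -/
theorem ap_adaptedPerron
    (hF4a : ∀ (k K : Type) [Field k] [Field K] [Algebra k K] (O : ValuationSubring K) (n : ℕ) (R : Subalgebra k K)
    (hRO : R.toSubring ≤ O.toSubring) (x : Fin n → K) (hx : ∀ i, x i ∈ R) (lv : Fin n → ℕ),
    FlagAdaptedChart O R hRO x hx lv →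
    (∀ z : K, z ≠ 0 → ∃ N : ℕ, N ≠ 0 ∧ ∃ m : Fin n → ℤ, O.valuation z ^ N = ∏ i, O.valuation (x i) ^ (m i)) →
    ∀ (top : ℕ), (∀ i, lv i ≤ top) → (∃ i, lv i = top) → (∃ i, lv i < top) →
    ∃ (W : ValuationSubring K) (hOW : O ≤ W),
      (∀ z : K, z ∈ W ↔ ∃ m : Fin n → ℤ, (∀ j, top ≤ lv j → m j = 0) ∧
        O.valuation z ≤ ∏ j, O.valuation (x j) ^ (m j)) ∧
      (∀ z w : K, W.valuation z < 1 → w ≠ 0 → ∃ N : ℕ, W.valuation z ^ N < W.valuation w) ∧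
      (∀ i, lv i < top → W.valuation (x i) = 1) ∧
      ∃ (nT : ℕ) (e : Fin nT ≃ {i : Fin n // lv i = top}),
        Ideal.span (Set.range fun j => (⟨x (e j).1, hx (e j).1⟩ : R.toSubring)) =
          Ideal.comap (Subring.inclusion (hRO.trans (fun _ hz => hOW hz))) (maximalIdeal W) ∧
        (∀ m : Fin nT → ℤ, (∏ j, W.valuation (x (e j).1) ^ (m j)) = 1 → m = 0))
    (hF4b : ∀ (k K : Type) [Field k] [Field K] [Algebra k K] (O : ValuationSubring K)
    (hk : ∀ c : k, algebraMap k K c ∈ O) (n : ℕ) (R : Subalgebra k K)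
    (hRO : R.toSubring ≤ O.toSubring) (x : Fin n → K) (hx : ∀ i, x i ∈ R) (lv : Fin n → ℕ),
    FlagAdaptedChart O R hRO x hx lv →
    ∀ (top : ℕ), (∀ i, lv i ≤ top) → (∃ i, lv i = top) → (∃ i, lv i < top) →
    ∀ (W : ValuationSubring K) (hOW : O ≤ W),
      (∀ z : K, z ∈ W ↔ ∃ m : Fin n → ℤ, (∀ j, top ≤ lv j → m j = 0) ∧
        O.valuation z ≤ ∏ j, O.valuation (x j) ^ (m j)) →
      letI := algebraOfMem k W (fun c => hOW (hk c))
      ∃ (nS : ℕ) (e : Fin nS ≃ {i : Fin n // lv i < top}) (Rb : Subalgebra k (ResidueField W))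
        (hRb : Rb.toSubring ≤ (residueValuationSubring O W hOW).toSubring),
        (∀ (r : K) (hr : r ∈ R), residue W ⟨r, hOW (hRO hr)⟩ ∈ Rb) ∧
        (∀ rb ∈ Rb, ∃ (r : K) (hr : r ∈ R), residue W ⟨r, hOW (hRO hr)⟩ = rb) ∧
        ∃ (hxb : ∀ j, residue W ⟨x (e j).1, hOW (hRO (hx (e j).1))⟩ ∈ Rb),
        FlagAdaptedChart (residueValuationSubring O W hOW) Rb hRb
          (fun j => residue W ⟨x (e j).1, hOW (hRO (hx (e j).1))⟩) hxb (fun j => lv (e j).1) ∧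
        (∀ (r : K) (hr : r ∈ R), residue W ⟨r, hOW (hRO hr)⟩ = 0 ↔
          (⟨r, hr⟩ : R.toSubring) ∈ Ideal.span (Set.range
            fun i : {i : Fin n // lv i = top} => (⟨x i.1, hx i.1⟩ : R.toSubring))) ∧
        (∀ (r r' : K) (hr : r ∈ R) (hr' : r' ∈ R), W.valuation r = 1 → W.valuation r' = 1 →
          ((residueValuationSubring O W hOW).valuation (residue W ⟨r, hOW (hRO hr)⟩) ≤
              (residueValuationSubring O W hOW).valuation (residue W ⟨r', hOW (hRO hr')⟩) ↔
            O.valuation r ≤ O.valuation r'))) :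
    ∀ (n : ℕ) (k K : Type) [Field k] [Field K] [Algebra k K] (O : ValuationSubring K)
      (hk : ∀ c : k, algebraMap k K c ∈ O) (R : Subalgebra k K)
      (hRO : R.toSubring ≤ O.toSubring) (x : Fin n → K) (hx : ∀ i, x i ∈ R) (lv : Fin n → ℕ),
      FlagAdaptedChart O R hRO x hx lv →
      (∀ z : K, z ≠ 0 → ∃ N : ℕ, N ≠ 0 ∧ ∃ m : Fin n → ℤ, O.valuation z ^ N = ∏ i, O.valuation (x i) ^ (m i)) →
      ∀ (ma : ℕ) (a : Fin ma → K), (∀ j, a j ∈ R ∧ a j ≠ 0) →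
      ∀ (l : ℕ) (h : Fin l → Fin n → ℤ), (∀ j, (∏ i, O.valuation (x i) ^ (h j i)) ≤ 1) →
      ∃ (R' : Subalgebra k K) (hR'O : R'.toSubring ≤ O.toSubring) (x' : Fin n → K)
        (hx' : ∀ i, x' i ∈ R') (lv' : Fin n → ℕ),
        R ≤ R' ∧ R' = Algebra.adjoin k ((R : Set K) ∪ Set.range x') ∧
        FlagAdaptedChart O R' hR'O x' hx' lv' ∧
        (∀ j, ∃ c : Fin n → ℤ, x' j = ∏ i, x i ^ (c i)) ∧
        (∀ i, ∃ d : Fin n → ℕ, x i = ∏ j, x' j ^ (d j)) ∧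
        (∀ j, ∃ (α : Fin n → ℕ) (u : K), u ∈ R' ∧ O.valuation u = 1 ∧
          a j = (∏ i, x' i ^ (α i)) * u) ∧
        (∀ j, ∃ e : Fin n → ℕ, (∏ i, x i ^ (h j i)) = ∏ i, x' i ^ (e i)) := by
  intro n
  induction n using Nat.strong_induction_on with
  | _ n IH =>
  intro k K _ _ _ O hk R hRO x hx lv hflag htors ma a ha l h hh
  classical
  obtain ⟨⟨hRFG, hx0, hspan, hind, ⟨hC2a, hC2b, hC4⟩, hC3⟩, hLA⟩ := hflag
  have hvx0 : ∀ i, O.valuation (x i) ≠ 0 := fun i => (map_ne_zero _).mpr (hx0 i)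
  have hprodK : ∀ m : Fin n → ℤ, O.valuation (∏ j, x j ^ (m j)) = ∏ j, O.valuation (x j) ^ (m j) := by
    intro m; rw [map_prod]; exact Finset.prod_congr rfl fun j _ => map_zpow₀ _ _ _
  have hpos : ∀ m : Fin n → ℤ, 0 < ∏ j, O.valuation (x j) ^ (m j) := fun m =>
    Finset.prod_pos fun j _ => zpow_pos (zero_lt_iff.mpr (hvx0 j)) _
  have hxlt : ∀ i, O.valuation (x i) < 1 := by
    intro i
    have h1 : (⟨x i, hx i⟩ : R.toSubring) ∈ Ideal.comap (Subring.inclusion hRO) (maximalIdeal O) := by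
      rw [← hspan]; exact Ideal.subset_span ⟨i, rfl⟩
    rw [Ideal.mem_comap, ValuationSubring.valuation_lt_one_iff] at h1
    exact h1
  -- the top level
  set top : ℕ := Finset.univ.sup lv with htop
  have hle : ∀ i, lv i ≤ top := fun i => Finset.le_sup (Finset.mem_univ i)
  by_cases hone : ∀ i, lv i = top
  · -- ONE LEVEL: rank one
    exact ap_ap_oneLevel O R hRO x hx lv hRFG hx0 hspan hind hLA htors top hone a ha h hh
  · ----------------------------------------------------------------
    -- AT LEAST TWO LEVELS
    ----------------------------------------------------------------
    have hflag' : FlagAdaptedChart O R hRO x hx lv := ⟨⟨hRFG, hx0, hspan, hind, ⟨hC2a, hC2b, hC4⟩, hC3⟩, hLA⟩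
    have hS : ∃ i, lv i < top := by
      push Not at hone
      obtain ⟨i, hi⟩ := hone
      exact ⟨i, lt_of_le_of_ne (hle i) hi⟩
    have hn : (Finset.univ : Finset (Fin n)).Nonempty := by
      obtain ⟨i, -⟩ := hS; exact ⟨i, Finset.mem_univ i⟩
    have hT : ∃ i, lv i = top := by
      obtain ⟨i, -, hi⟩ := Finset.exists_mem_eq_sup _ hn lv
      exact ⟨i, hi.symm⟩
    -- the top coarsening (F4a) and the residual chart (F4b)
    obtain ⟨W, hOW, hWmem, hWr1, hWlow, nT, eT, hWspan, hWind⟩ :=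
      hF4a k K O n R hRO x hx lv hflag' htors top hle hT hS
    letI := algebraOfMem k W (fun c => hOW (hk c))
    obtain ⟨nS, eS, Rb, hRb, hπR, hπsurj, hxb, hbflag, hker, hdict⟩ :=
      hF4b k K O hk n R hRO x hx lv hflag' top hle hT hS W hOW hWmem
    set Ob := residueValuationSubring O W hOW with hOb
    have hRW : R.toSubring ≤ W.toSubring := fun z hz => hOW (hRO hz)
    -- `W`-smallness
    have hWlt : ∀ z : K, W.valuation z < 1 ↔
        ∀ m : Fin n → ℤ, (∀ j, top ≤ lv j → m j = 0) → O.valuation z < ∏ j, O.valuation (x j) ^ (m j) :=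
      ap_valuation_lt_one_iff_forall O W x (fun m => ∀ j, top ≤ lv j → m j = 0) hx0
        (fun _ _ => rfl) (fun m hm j hj => by rw [Pi.neg_apply, hm j hj, neg_zero]) hWmem
    have hWO : ∀ z : K, W.valuation z < 1 → O.valuation z < 1 := by
      intro z hz; have h := (hWlt z).mp hz 0 (fun _ _ => rfl); simpa using h
    have hOWv : ∀ z : K, O.valuation z ≤ 1 → W.valuation z ≤ 1 := fun z hz =>
      (W.valuation_le_one_iff z).mpr (hOW ((O.valuation_le_one_iff z).mp hz))
    -- lower parameters are `W`-units
    have hlowW : ∀ i, lv i < top → x i ∈ W ∧ (x i)⁻¹ ∈ W := fun i hi =>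
      (ap_valuation_eq_one_iff_mem_inv_mem W (hx0 i)).mp (hWlow i hi)
    -- splitting products along top / lower indices
    have hsplit := fun (N : Type) [CommMonoid N] (f : Fin n → N) => ap_prod_split lv top eT eS hle f
    -- the `W`-values of the `h j`
    have hhT : ∀ j, (∏ t, W.valuation (x (eT t)) ^ (h j (eT t))) ≤ 1 := by
      intro j
      have h1 : W.valuation (∏ i, x i ^ (h j i)) ≤ 1 := by
        apply hOWv; rw [hprodK]; exact hh j
      have h2 : W.valuation (∏ i, x i ^ (h j i)) = ∏ i, W.valuation (x i) ^ (h j i) := by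
        rw [map_prod]; exact Finset.prod_congr rfl fun i _ => map_zpow₀ _ _ _
      rw [h2, hsplit _ (fun i => W.valuation (x i) ^ (h j i))] at h1
      have h3 : (∏ s, W.valuation (x (eS s)) ^ (h j (eS s))) = 1 :=
        Finset.prod_eq_one fun s _ => by rw [hWlow _ (eS s).2, one_zpow]
      rwa [h3, mul_one] at h1
    -- STEP 1: rank-one explicit Perron monomialization on the top coarsening
    obtain ⟨R₁, hR₁W, xT, hxT, hRR₁, hR₁FG, hsub₁, hxT0, hspan₁, hind₁, hxTd, haj₁, hhj₁, hR₁eq, hxTc, hxTlt⟩ :=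
      perronMonomialization_explicit k K W nT R hRW (fun t => x (eT t)) (fun t => hx _) hRFG
        (fun t => hx0 _) hWspan hWind hWr1 ma a ha l (fun j t => h j (eT t)) hhT
    have hR₁O : R₁.toSubring ≤ O.toSubring := by
      intro z hz
      have hz' : z ∈ Algebra.adjoin k ((R : Set K) ∪ Set.range xT) := by rw [← hR₁eq]; exact hz
      refine (Algebra.adjoin_le (S := { O.toSubring with algebraMap_mem' := fun c => hk c }) ?_) hz'
      rintro w (hw | ⟨t, rfl⟩)
      · exact hRO hw
      · exact (O.valuation_le_one_iff _).mp (hWO _ (hxTlt t)).le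
    -- residues of elements of `R₁` lie in the residual chart `Rb`
    have hπR₁ : ∀ (r : K) (hr : r ∈ R₁), residue W ⟨r, hOW (hR₁O hr)⟩ ∈ Rb := fun r hr =>
      ap_residue_adjoin_mem W Rb R (Set.range xT) (fun w hw => hOW (hR₁O (by rw [hR₁eq]; exact hw)))
        (fun w hw _ => hπR w hw)
        (by rintro _ ⟨t, rfl⟩ hwW; rw [(ap_residue_eq_zero_iff W hwW).mpr (hxTlt t)]; exact Rb.zero_mem) r
        (by rw [← hR₁eq]; exact hr) _
    -- STEP 2: the induction hypothesis in the residue field of `W`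
    -- the ground field lies in the residue valuation ring
    have hkV : ∀ c : k, algebraMap k (ResidueField W) c ∈ Ob := by
      intro c
      have : algebraMap k (ResidueField W) c = residue W ⟨algebraMap k K c, hOW (hk c)⟩ := rfl
      rw [this, hOb, residue_mem_residueValuationSubring_iff]; exact hk c
    -- lower monomials, residues, transfer (as in the UP-lemma)
    have hmonW : ∀ m : Fin nS → ℤ, (∏ s, x (eS s) ^ (m s)) ∈ W := by
      intro m
      refine prod_mem fun s _ => ?_
      rcases Int.eq_nat_or_neg (m s) with ⟨N, hN | hN⟩
      · rw [hN, zpow_natCast]; exact pow_mem (hlowW _ (eS s).2).1 N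
      · rw [hN, zpow_neg, zpow_natCast, ← inv_pow]; exact pow_mem (hlowW _ (eS s).2).2 N
    have hmonu : ∀ m : Fin nS → ℤ, W.valuation (∏ s, x (eS s) ^ (m s)) = 1 := by
      intro m; rw [map_prod]; exact Finset.prod_eq_one fun s _ => by rw [map_zpow₀, hWlow _ (eS s).2, one_zpow]
    have hmonπ : ∀ m : Fin nS → ℤ, residue W ⟨∏ s, x (eS s) ^ (m s), hmonW m⟩ =
        ∏ s, residue W ⟨x (eS s).1, hOW (hRO (hx (eS s).1))⟩ ^ (m s) :=
      fun m => ap_residue_prod_zpow W (fun s => x (eS s)) (fun s => (hlowW _ (eS s).2).1)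
        (fun s => (hlowW _ (eS s).2).2) (fun s => hx0 _) m (hmonW m)
    have hmonOb : ∀ m : Fin nS → ℤ,
        (∏ s, Ob.valuation (residue W ⟨x (eS s).1, hOW (hRO (hx (eS s).1))⟩) ^ (m s)) =
        Ob.valuation (residue W ⟨∏ s, x (eS s) ^ (m s), hmonW m⟩) := by
      intro m; rw [hmonπ, map_prod]
      exact Finset.prod_congr rfl fun s _ => (map_zpow₀ _ _ _).symm
    have hmonO : ∀ m : Fin nS → ℤ, O.valuation (∏ s, x (eS s) ^ (m s)) = ∏ s, O.valuation (x (eS s)) ^ (m s) := by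
      intro m; rw [map_prod]; exact Finset.prod_congr rfl fun s _ => map_zpow₀ _ _ _
    -- value torsion in the residue field
    have htorsV := ap_ap_torsV O R hRO x hx hx0 lv top hle W hOW hWlow eT hWind eS hlowW htors
    -- the units of STEP 1 and their residues
    choose α₁ c₁ hc₁R hc₁u hac using haj₁
    have hcb : ∀ j, residue W ⟨c₁ j, hOW (hR₁O (hc₁R j))⟩ ∈ Rb ∧ residue W ⟨c₁ j, hOW (hR₁O (hc₁R j))⟩ ≠ 0 :=
      fun j => ⟨hπR₁ _ (hc₁R j), ap_residue_ne_zero_of_valuation_eq_one W _ (hc₁u j)⟩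
    -- the pure-lower `h j`, restricted to the lower indices
    have hhb : ∀ j, (∏ s, Ob.valuation (residue W ⟨x (eS s).1, hOW (hRO (hx (eS s).1))⟩) ^
        ((if ∀ t, h j (eT t) = 0 then (fun s => h j (eS s)) else 0 : Fin nS → ℤ) s)) ≤ 1 := by
      intro j
      split_ifs with hjT
      · rw [hmonOb, ap_resval_le_one_iff O W hOW (hmonW _), hmonO]
        have h1 := hh j
        rw [hsplit _ (fun i => O.valuation (x i) ^ (h j i))] at h1
        have h3 : (∏ t, O.valuation (x (eT t)) ^ (h j (eT t))) = 1 :=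
          Finset.prod_eq_one fun t _ => by rw [hjT t, zpow_zero]
        rwa [h3, one_mul] at h1
      · simp
    -- fewer parameters below
    have hnS : nS < n := by
      obtain ⟨i₀, hi₀⟩ := hT
      have h1 : Fintype.card (Fin nS) = Fintype.card {i : Fin n // lv i < top} := Fintype.card_congr eS
      have h2 : Fintype.card {i : Fin n // lv i < top} < Fintype.card (Fin n) :=
        Fintype.card_subtype_lt (x := i₀) (by rw [hi₀]; exact lt_irrefl _)
      rw [← h1, Fintype.card_fin, Fintype.card_fin] at h2
      exact h2
    obtain ⟨Rb', hRb'O, xb', hxb', lvS', hRbRb', hRb'eq, hbflag', hxb'c, hxbd, hcbj, hhbj⟩ :=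
      IH nS hnS k (ResidueField W) Ob hkV Rb hRb (fun s => residue W ⟨x (eS s).1, hOW (hRO (hx (eS s).1))⟩)
        hxb (fun s => lv (eS s).1) hbflag htorsV ma (fun j => residue W ⟨c₁ j, hOW (hR₁O (hc₁R j))⟩) hcb
        l (fun j => if ∀ t, h j (eT t) = 0 then (fun s => h j (eS s)) else 0) hhb
    -- unpack the induction hypothesis
    obtain ⟨⟨hRb'FG, hxb'0, hbspan', hbind', hbAV', hbC3'⟩, hbLA'⟩ := id hbflag'
    obtain ⟨⟨-, hxbb0, hbspan, hbind, -, -⟩, -⟩ := id hbflag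
    choose C' hC' using hxb'c
    choose D' hD' using hxbd
    choose β ub hubR hubu hcbeq using hcbj
    choose eb heb using hhbj
    obtain ⟨i₀, hi₀⟩ := hT
    -- STEP 3 (lift, uniform exponent, type-2): `…APStep1`
    obtain ⟨u, huW, Q, B, hBW, hBO, N₀, tsel, e₁, g, mv, bsum, dv, E, z, R₃, hR₃O, hR₃W, hzR₃, hxTB, hQB, hBR₃,
        hu, hB, huu, hu0, huπ, huv, hxu, hQ0, hR₁B, huB, hthrow, htsel, he₁, hgmon, hmvge, hmvdv, hβle, hE, hQE, hz,
        hzW1, hzW, hz0, hR₃, hspan₃, hxTz, hπR₃, hsurj₃, hsurjB, humonπ, humonB, hR₃FG⟩ :=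
      ap_ap_step1b O hk R hRO x hx lv top hx0 i₀ hi₀ W hOW hWlow hWO eT hWind eS hlowW Rb hπsurj (fun _ => rfl)
        hxbb0 hbind R₁ hR₁W xT hxT hRR₁ hR₁FG hxT0 hspan₁ h hhj₁ hxTlt hR₁O hπR₁ Rb' hRb'O xb' hxb' hRbRb' hRb'eq
        hbspan' C' hC' D' hD' β
    have hBFG : B.FG := by
      obtain ⟨s₁, hs₁⟩ := hR₁FG
      refine ⟨s₁ ∪ Finset.univ.image u, ?_⟩
      rw [Finset.coe_union, Finset.coe_image, Finset.coe_univ, Set.image_univ, Algebra.adjoin_union, hs₁, hB,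
        Algebra.adjoin_union, Algebra.adjoin_eq]
    -- STEP 4 (final system, UP-lemma): `…APStep2`
    obtain ⟨xf, hxfR₃, lvf, hxf, hxfT, hxfS, hxf0, hflag₃, hEXTN, hEXTZx, hxvS⟩ :=
      ap_ap_step2 O hk x lv top hle hx0 i₀ hi₀ W hOW hWmem hWr1 eT eS xT hind₁ Rb' hRb'O xb' hxb' lvS' hbflag'
        u huW C' hu hu0 huπ huv D' hxu B huB hBFG z hzW1 hz0 R₃ hR₃O hR₃W hzR₃ hBR₃ hR₃ hspan₃ hπR₃ hsurj₃
    -- the conclusions: `…APStep3`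
    obtain ⟨hRR₃, hR₃eq, hc_fin, hd_fin, ha_fin, hh_fin⟩ :=
      ap_ap_step3 O R hRO x hx lv top hle hx0 W hOW hWlow hWO eT eS hlowW R₁ xT hRR₁ hind₁ hxTd a α₁ c₁ hc₁R
        hR₁O hac h hR₁eq hxTc Rb' xb' β ub hubR hubu hcbeq eb heb u Q B hBW hBO N₀ tsel e₁ g mv bsum dv E z R₃
        hR₃O hzR₃ hxTB hQB hBR₃ C' D' hB hu huu hu0 hxu hQ0 hR₁B hthrow htsel he₁ hgmon hmvge hmvdv hβle hE hQE
        hz hzW hR₃ hxTz hsurjB humonπ humonB xf hxfR₃ lvf hxf hxfT hxfS hflag₃ hEXTN hEXTZx hxvS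
    exact ⟨R₃, hR₃O, xf, hxfR₃, lvf, hRR₃, hR₃eq, hflag₃, hc_fin, hd_fin, ha_fin, hh_fin⟩

/-- **Perron monomialization on flag-adapted charts, ANY RANK — unconditionally** (registered
anchor, closed form): `ap_adaptedPerron` fed with the landed F⁴ᵃ `stub_topCoarsening` (w-F4a) and
F⁴ᵇ `stub_residualChart` (w-F4b). This is the rank-free replacement of S3 in the tower argument
for the rank `≥ 2` Abhyankar core. [folklore] -/
theorem ap_adaptedPerron_flag : ∀ (n : ℕ) (k K : Type) [Field k] [Field K] [Algebra k K] (O : ValuationSubring K) (hk : ∀ c : k, algebraMap k K c ∈ O) (R : Subalgebra k K) (hRO : R.toSubring ≤ O.toSubring) (x : Fin n → K) (hx : ∀ i, x i ∈ R) (lv : Fin n → ℕ), FlagAdaptedChart O R hRO x hx lv → (∀ z : K, z ≠ 0 → ∃ N : ℕ, N ≠ 0 ∧ ∃ m : Fin n → ℤ, O.valuation z ^ N = ∏ i, O.valuation (x i) ^ (m i)) → ∀ (ma : ℕ) (a : Fin ma → K), (∀ j, a j ∈ R ∧ a j ≠ 0) → ∀ (l : ℕ) (h : Fin l → Fin n →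 ℤ), (∀ j, (∏ i, O.valuation (x i) ^ (h j i)) ≤ 1) → ∃ (R' : Subalgebra k K) (hR'O : R'.toSubring ≤ O.toSubring) (x' : Fin n → K) (hx' : ∀ i, x' i ∈ R') (lv' : Fin n → ℕ), R ≤ R' ∧ R' = Algebra.adjoin k ((R : Set K) ∪ Set.range x') ∧ FlagAdaptedChart O R' hR'O x' hx' lv' ∧ (∀ j, ∃ c : Fin n → ℤ, x' j = ∏ i, x i ^ (c i)) ∧ (∀ i, ∃ d : Fin n → ℕ, x i = ∏ j, x' j ^ (d j)) ∧ (∀ j, ∃ (α : Fin n → ℕ) (u : K), u ∈ R' ∧ O.valuation u = 1 ∧ a j = (∏ i, x' i ^ (α i)) * u) ∧ (∀ j, ∃ e : Fin n → ℕ, (∏ i, x i ^ (h j i)) = ∏ i, x' i ^ (e i)) :=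
  ap_adaptedPerron stub_topCoarsening stub_residualChart

end Main

end Summit.ResolutionOfSingularities.ResolutionOfSingularities.Theorems.PfaffLine
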